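import Summits.CriticalPhenomena.CardyFormulaZ2.Theses.CardyIsoradial
import Literature.Probability.Percolation.IsoradialSquareLatticeGMTiling
import Literature.Probability.Percolation.IsoradialRectangularCrossings

/-!
# Birth skeleton (BC3) — crux `CrossingLimitInvariance` (stmt-CriticalPhenomena-0785)

Route `route-CriticalPhenomena-CardyIsoradial` (rank-2 crux, the route's engine), sub-problem
`CardyFormulaZ2`. The crux is FIXED (route decl, quoted by name below):

  `CrossingLimitInvariance` — for every `Φ : ℝ → ℝ`, if ONE graph `(G, emb)` of Grimmett–Manolescu's
  class `𝒢` (preconnected, `IsIsoradial`, `IsRhombicTiling`, `HasSquareGridProperty`, `BAP(ε)`) has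
  crossing limits `Φ` for every conformal rectangle `R` (crude event `embDomainCrossing emb.z R.carrier δ
  (R.arc 0) (R.arc 2)` under the canonical law `emb.isoradialPercolation`, `δ → 0⁺`), then EVERY graph
  `(G', emb')` of `𝒢` has the same limits `Φ`.

## The line: Grimmett–Manolescu's two-stage star–triangle transport, at `o(1)` precision, in
## COUPLING FORM (vanishing DIFFERENCES — no limit function `Φ` appears in any stub)

GM prove universality of arm EXPONENTS across `𝒢` (arXiv:1204.0505 = PTRF 159 (2014), §3 Theorem
"Universality"; tree fact `Literature.Probability.Percolation.gm_universality_arms`) in two stages, both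
up to multiplicative constants: (§8.4, Lemma "general case") a graph `G ∈ 𝒢` is converted, inside a
window, into its associated ISORADIAL SQUARE LATTICE `G_{α,β}` (`α` = transverse angles of the tracks
`r_i` other than the grid family `(s_j)`, `β` = those of the `s_j`; §7 Lemma "grid slide": "`G^K` agrees
with `G_{α,β}` inside this domain") by a finite sequence of star–triangle transformations that moves the
track intersections out of the window; (§8.3, Corollary) any two isoradial square lattices `G_{α,β}`,
`G_{α',β'}` in `BAP(ε)` are compared through the track exchanges `Σ_j` of §5.3/§6 (`U_m`). The tree HAS
the hub objects: `Literature.Probability.Percolation.gmEmbedding α β : RhombicEmbedding (zdGraph 2)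
(Site 2)` is GM's `G_{α,β}` (§4.6), a member of `𝒢(ε)` exactly when `β_j - α_i ∈ [2ε, π - 2ε]` (the
paper's (4.5) in the tree's half-angle units) — `isIsoradial_gmEmbedding`, `isRhombicTiling_gmEmbedding`,
`hasSquareGridPropertyGM_gmEmbedding`, `hasBoundedAngles_gmEmbedding_iff`, `gmEmbedding_preconnected`
(all proved; certificate `gm_mem_class` below) — and `G_{-π/4,π/4} = squareLatticeEmbedding`
(`gmEmbedding_squareLattice`), so `ℤ²` at `p = 1/2` is itself a hub lattice.

The crux asks for the `o(1)` upgrade of this transport for MACROSCOPIC CROSSING PROBABILITIES. The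
skeleton isolates the three places where `o(1)` content lives, each stated as "a difference of two
crossing probabilities tends to `0` as `δ → 0⁺`" (coupling form; strictly stronger in kind than
transporting an existing limit, and free of `Φ`):

* `stub_gridReduction` (GM §7/§8.4 at `o(1)`; size XL, HARDEST): every `(G, emb) ∈ 𝒢(ε)` has a hub
  lattice `G_{α,β}`, `β_j - α_i ∈ [2ε', π - 2ε']`, whose crude crossing probabilities differ from those
  of `G` by `o(1)` for every conformal rectangle. Content beyond print: the grid-slide `R^±` displaces an
  open path by one rhombus per star–triangle move and GM only bound the cumulated displacement by a
  constant factor in the diamond metric (`c_d`, (8.2)); `o(1)` needs "no macroscopic drift" of large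
  clusters under `≍ δ⁻²` moves (arm separation + a quantitative bookkeeping of the moves, as DKKMO do for
  rectangular lattices), for track systems with NO periodicity (𝒢 contains Penrose-type rhombic tilings,
  GM §4.3.3). Intended witness: GM's `(α, β)` (transverse angles of `(r_i)`, `(s_j)`), `ε' = ε` under
  the printed SGP; the statement only asks for SOME hub in some `BAP(ε')`.
* `stub_squareGridUniversality` (GM §8.3 Corollary at `o(1)` = DKKMO Theorem 2.1 extended from the
  rectangular lattices `𝕃(θ)` = `G_{θ₁,θ₂}` with CONSTANT sequences to arbitrary `BAP` sequences; size
  XL): any two hub lattices have asymptotically equal Schramm–Smirnov quad-crossing probabilities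
  `quadCrossingEmb (gmEmbedding α β).z R δ` (the event of the tree's DKKMO file
  `IsoradialRectangularCrossings`, drawn along the embedding). PRINTED SPECIAL CASE: both sequences
  constant on both sides is `Literature.Probability.Percolation.DKKMO2020_thm21_quadCrossingProb`
  (arXiv:2012.11672 Thm 2.1 at `q = 1`, up to a rotation of the drawing: `G_{θ₁,θ₂} =
  e^{i(θ₁+θ₂)/2} · isoRectEmbedding (θ₂ - θ₁)`); bi-periodic sequences are announced
  (Manolescu arXiv:2502.08394v2 Rem. 5.6, [HM24]); aperiodic sequences are open.
* `stub_quadToCrude` (boundary continuity on hub lattices; size L): on every hub lattice the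
  quad-crossing probability and the crude `embDomainCrossing` probability of a conformal rectangle differ
  by `o(1)` — the passage "from `𝒞_δ(Q)` to the discrete-arc events `embDomainCrossing`" that the DKKMO
  file's module docstring leaves to the routes (RSW in boundary annuli of the quad, uniform in the mesh;
  inputs `hasBoxCrossingProperty_gmEmbedding_of_gm_boxCrossing`, annulus circuits around the four marked
  points). Honest risk: quantified over EVERY Jordan rectangle (boundaries of positive area included), as
  is the crux.

Composition `CrossingLimitInvariance_of` (real proof, no `sorry`): for `G` (with limits `Φ`) and `G'`
take hubs `H = G_{α,β}`, `H' = G_{α',β'}` from stub A; then, for each rectangle `R`,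
`P_{G'} = (P_{G'} - P^crude_{H'}) - (P^quad_{H'} - P^crude_{H'}) - (P^quad_H - P^quad_{H'})
        + (P^quad_H - P^crude_H) - (P_G - P^crude_H) + P_G  →  0 - 0 - 0 + 0 - 0 + Φ(η) = Φ(η)`
by stubs A, C, B, C, A and the hypothesis — limit algebra (`Filter.Tendsto.add/sub`, `ring`).

Device (D-0027 §3.3, as in `Cruxes/CardyRigidity/Lines/birth.lean`): each stub is a sorried theorem
`Holds.stub_<name> : <full statement over tree declarations>` (registered under the short name
`stub_<name>` with that text) plus the by-name handle `def stub_<name> : Prop := type_of% Holds.stub_<name>`;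
the hypotheses of `CrossingLimitInvariance_of` are exactly these handles, by name, and
`CrossingLimitInvariance_proof : CrossingLimitInvariance` applies it to the three sorried stubs (so `sorryAx`
enters ONLY through `Holds.stub_*`).

Disproof / negatives honoured: no `Disproof.lean` exists for this crux (`ledger crux ls
stmt-CriticalPhenomena-0785`: no workfiles, 2026-08-17); `ledger negatives --problem CriticalPhenomena` was
read by the route's planners/refuters (item notes) — no stub is a refuted statement: none mentions
`CardyUniversality`, the refuted abstract Schramm principle, or a hand-picked threshold; the refuter's
recorded caveat (a formal `¬`crux cannot use two rectangular embeddings `𝕃(α)` of `ℤ²`, DKKMO Thm 2.1)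
is exactly the printed special case of stub B, not a counterexample to it.
-/

noncomputable section

namespace Summit.CriticalPhenomena.CardyFormulaZ2.Cruxes.CrossingLimitInvariance.Birth

open Filter Topology
open Summit.CriticalPhenomena.CardyFormulaZ2.Theses.CardyIsoradial (CrossingLimitInvariance)

/-! ### Certificate: the hub lattices `G_{α,β}` range INSIDE the crux's class `𝒢` (proved) -/

/-- The hub lattices of the line are members of the crux's class: for `0 < ε` and
`β_j - α_i ∈ [2ε, π - 2ε]`, GM's isoradial square lattice `G_{α,β}` (`gmEmbedding α β`) is a
preconnected, isoradial rhombic tiling with the square-grid property and `BAP(ε)` — so stubs B and C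
speak about a SUBCLASS of the graphs the crux quantifies over (all five conjuncts are tree theorems). -/
theorem gm_mem_class {α β : ℤ → ℝ} {ε : ℝ} (hε : 0 < ε)
    (h : ∀ i j : ℤ, 2 * ε ≤ β j - α i ∧ β j - α i ≤ Real.pi - 2 * ε) :
    (Literature.Probability.LatticeModels.zdGraph 2).Preconnected ∧
      (Literature.Probability.Percolation.gmEmbedding α β).IsIsoradial ∧
      (Literature.Probability.Percolation.gmEmbedding α β).IsRhombicTiling ∧
      (Literature.Probability.Percolation.gmEmbedding α β).HasSquareGridProperty ∧
      (Literature.Probability.Percolation.gmEmbedding α β).HasBoundedAngles ε :=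
  ⟨Literature.Probability.Percolation.gmEmbedding_preconnected,
    Literature.Probability.Percolation.isIsoradial_gmEmbedding fun i j =>
      ⟨by linarith [(h i j).1], by linarith [(h i j).2, hε]⟩,
    Literature.Probability.Percolation.isRhombicTiling_gmEmbedding hε h,
    (Literature.Probability.Percolation.hasSquareGridPropertyGM_gmEmbedding α β).hasSquareGridProperty,
    Literature.Probability.Percolation.hasBoundedAngles_gmEmbedding hε h⟩

/-- `ℤ²` with its isoradial embedding is itself a hub lattice: `squareLatticeEmbedding = G_{-π/4,π/4}`
(tree theorem `gmEmbedding_squareLattice`), with angles `β_j - α_i = π/2 ∈ [2·(π/4), π - 2·(π/4)]`. -/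
theorem squareLattice_is_hub :
    Literature.Probability.LatticeModels.squareLatticeEmbedding =
      Literature.Probability.Percolation.gmEmbedding (fun _ => -(Real.pi / 4)) (fun _ => Real.pi / 4) :=
  Literature.Probability.Percolation.gmEmbedding_squareLattice.symm

/-! ### The three registered stubs (the ONLY `sorry`s of this file) and their by-name handles -/

/-- **Stub A — grid reduction at `o(1)` (GM §7 "grid slide" + §8.4, upgraded from constant factors to
vanishing differences; HARDEST, size XL).** Every graph of the crux's class `𝒢(ε)` has an isoradial
square lattice `G_{α,β}` in some `BAP(ε')` (intended: `α`, `β` = the transverse angles of its track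
families `(r_i)`, `(s_j)`) whose crude crossing probabilities of every conformal rectangle differ from
its own by `o(1)` as `δ → 0⁺` (both under the canonical laws `isoradialPercolation`). -/
protected theorem Holds.stub_gridReduction :
    ∀ (V F : Type) [Countable V] [DecidableEq V] [DecidableEq F] (G : SimpleGraph V) [G.LocallyFinite]
      (emb : Literature.Probability.LatticeModels.RhombicEmbedding G F),
      G.Preconnected → emb.IsIsoradial → emb.IsRhombicTiling → emb.HasSquareGridProperty →
      ∀ ε : ℝ, 0 < ε → emb.HasBoundedAngles ε →
      ∃ (α β : ℤ → ℝ) (ε' : ℝ), 0 < ε' ∧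
        (∀ i j : ℤ, 2 * ε' ≤ β j - α i ∧ β j - α i ≤ Real.pi - 2 * ε') ∧
        ∀ R : Literature.Probability.RandomPlanarGeometry.ConformalRectangle,
          Tendsto
            (fun δ : ℝ =>
              emb.isoradialPercolation.real
                  (Literature.Probability.Percolation.embDomainCrossing emb.z R.carrier δ (R.arc 0)
                    (R.arc 2)) -
                (Literature.Probability.Percolation.gmEmbedding α β).isoradialPercolation.real
                  (Literature.Probability.Percolation.embDomainCrossing
                    (Literature.Probability.Percolation.gmEmbedding α β).z R.carrier δ (R.arc 0)
                    (R.arc 2)))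
            (𝓝[>] (0 : ℝ)) (𝓝 (0 : ℝ)) := by
  sorry

/-- By-name handle of the registered stub `Holds.stub_gridReduction`. -/
def stub_gridReduction : Prop := type_of% Holds.stub_gridReduction

/-- **Stub B — universality of quad crossings among isoradial square lattices at `o(1)` (GM §8.3
Corollary upgraded; = DKKMO arXiv:2012.11672 Thm 2.1 (`q = 1`) extended from constant to arbitrary
`BAP` angle sequences; size XL).** For any two hub lattices `G_{α,β} ∈ BAP(ε)`, `G_{α',β'} ∈ BAP(ε')`
and every conformal rectangle `R`, the Schramm–Smirnov quad-crossing probabilities (open edges drawn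
along the embeddings at mesh `δ`, tree event `quadCrossingEmb`) differ by `o(1)` as `δ → 0⁺`. Printed
case: all four sequences constant (`DKKMO2020_thm21_quadCrossingProb`, up to rotating the drawing). -/
protected theorem Holds.stub_squareGridUniversality :
    ∀ (α β : ℤ → ℝ) (ε : ℝ), 0 < ε →
      (∀ i j : ℤ, 2 * ε ≤ β j - α i ∧ β j - α i ≤ Real.pi - 2 * ε) →
      ∀ (α' β' : ℤ → ℝ) (ε' : ℝ), 0 < ε' →
      (∀ i j : ℤ, 2 * ε' ≤ β' j - α' i ∧ β' j - α' i ≤ Real.pi - 2 * ε') →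
      ∀ R : Literature.Probability.RandomPlanarGeometry.ConformalRectangle,
        Tendsto
          (fun δ : ℝ =>
            (Literature.Probability.Percolation.gmEmbedding α β).isoradialPercolation.real
                (Literature.Probability.Percolation.quadCrossingEmb
                  (Literature.Probability.Percolation.gmEmbedding α β).z R δ) -
              (Literature.Probability.Percolation.gmEmbedding α' β').isoradialPercolation.real
                (Literature.Probability.Percolation.quadCrossingEmb
                  (Literature.Probability.Percolation.gmEmbedding α' β').z R δ))
          (𝓝[>] (0 : ℝ)) (𝓝 (0 : ℝ)) := by
  sorry

/-- By-name handle of the registered stub `Holds.stub_squareGridUniversality`. -/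
def stub_squareGridUniversality : Prop := type_of% Holds.stub_squareGridUniversality

/-- **Stub C — quad event vs crude event on hub lattices (boundary continuity; size L).** On every
hub lattice `G_{α,β} ∈ BAP(ε)` and for every conformal rectangle, the Schramm–Smirnov quad-crossing
probability (`quadCrossingEmb`: a drawn open path inside the closed quad joining the arcs `(ab)`, `(cd)`)
and the crude crossing probability (`embDomainCrossing`: an open path with vertices in `Ω` between the
`2δ`-neighbourhoods of the arcs) differ by `o(1)` as `δ → 0⁺` — the two events disagree only through
boundary effects within `O(δ)` of `∂Ω`, paid for by RSW circuits in boundary annuli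
(`hasBoxCrossingProperty_gmEmbedding_of_gm_boxCrossing`) and annulus circuits around the marked points. -/
protected theorem Holds.stub_quadToCrude :
    ∀ (α β : ℤ → ℝ) (ε : ℝ), 0 < ε →
      (∀ i j : ℤ, 2 * ε ≤ β j - α i ∧ β j - α i ≤ Real.pi - 2 * ε) →
      ∀ R : Literature.Probability.RandomPlanarGeometry.ConformalRectangle,
        Tendsto
          (fun δ : ℝ =>
            (Literature.Probability.Percolation.gmEmbedding α β).isoradialPercolation.real
                (Literature.Probability.Percolation.quadCrossingEmb
                  (Literature.Probability.Percolation.gmEmbedding α β).z R δ) -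
              (Literature.Probability.Percolation.gmEmbedding α β).isoradialPercolation.real
                (Literature.Probability.Percolation.embDomainCrossing
                  (Literature.Probability.Percolation.gmEmbedding α β).z R.carrier δ (R.arc 0)
                  (R.arc 2)))
          (𝓝[>] (0 : ℝ)) (𝓝 (0 : ℝ)) := by
  sorry

/-- By-name handle of the registered stub `Holds.stub_quadToCrude`. -/
def stub_quadToCrude : Prop := type_of% Holds.stub_quadToCrude

/-! ### Composition (sorry-free): the three stubs imply the crux BY NAME -/

/-- **The composition (real proof).** Given `G ∈ 𝒢(ε)` with crossing limits `Φ` and a target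
`G' ∈ 𝒢(ε')`, stub A supplies hubs `H = G_{α,β}` for `G` and `H' = G_{α',β'}` for `G'`; for a conformal
rectangle `R` with uniformizing datum `(φ, x)`, `η = crossRatio x`,
`P_{G'} = (P_{G'} - P^cr_{H'}) - (P^q_{H'} - P^cr_{H'}) - (P^q_H - P^q_{H'}) + (P^q_H - P^cr_H)
- (P_G - P^cr_H) + P_G → 0 - 0 - 0 + 0 - 0 + Φ η` by stubs A, C, B, C, A and the hypothesis on `G`. -/
theorem CrossingLimitInvariance_of :
    stub_gridReduction → stub_squareGridUniversality → stub_quadToCrude → CrossingLimitInvariance := by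
  intro hA hB hC
  dsimp only [stub_gridReduction, stub_squareGridUniversality, stub_quadToCrude] at hA hB hC
  intro Φ V F _ _ _ G _ emb hpre hiso htile hsgp ε hε hbap hΦ V' F' _ _ _ G' _ emb' hpre' hiso'
    htile' hsgp' ε' hε' hbap' R φ x hφx
  obtain ⟨α, β, ε₁, hε₁, hang, hGH⟩ := hA V F G emb hpre hiso htile hsgp ε hε hbap
  obtain ⟨α', β', ε₁', hε₁', hang', hGH'⟩ := hA V' F' G' emb' hpre' hiso' htile' hsgp' ε' hε' hbap'
  -- the six convergent pieces
  have h0 := hΦ R φ x hφx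
  have h1 := hGH R
  have h2 := hC α β ε₁ hε₁ hang R
  have h3 := hB α β ε₁ hε₁ hang α' β' ε₁' hε₁' hang' R
  have h4 := hC α' β' ε₁' hε₁' hang' R
  have h5 := hGH' R
  have key := ((((h5.sub h4).sub h3).add h2).sub h1).add h0
  simp only [sub_zero, add_zero, zero_add] at key
  refine key.congr' (Eventually.of_forall fun δ => ?_)
  ring

/-- **The crux BY NAME from the three stubs** (depends on `sorryAx` ONLY through
`Holds.stub_gridReduction`, `Holds.stub_squareGridUniversality`, `Holds.stub_quadToCrude` — this line also
certifies mechanically that the handles ARE the stub statements). -/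
theorem CrossingLimitInvariance_proof : CrossingLimitInvariance :=
  CrossingLimitInvariance_of Holds.stub_gridReduction Holds.stub_squareGridUniversality
    Holds.stub_quadToCrude

end Summit.CriticalPhenomena.CardyFormulaZ2.Cruxes.CrossingLimitInvariance.Birth

end
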